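import Summits.FinalStateConjecture.FinalStateConjecture.Theses.TemporalBandLiouville
import HarnessLib.Audit

/-!
# Line `recur` — crux `Theses.TemporalBandLiouville.EternalExteriorStationary` (stmt-FinalStateConjecture-10170)
# cut along the TRANSLATION HULL: recurrent core + past-approach rigidity + compactness glue

Strategist: planner-cstrat-stmt-FinalStateConjecture-10170-s2-0, 2026-08-17.  ALTERNATIVE line (`--alt`); it does not
touch the live skeleton `Lines/birth.lean` (temporal band: C1 `BandFromNonradiation` → C2 `BandLimitedLiouville`) nor the
sibling route's strip cut (LeakageWritesInInk: `LeakageTimeAnalyticity` → `TimeAnalyticLiouville`).  The crux X is FIXED and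
concluded BY NAME (`EternalExteriorStationary_of`, from the three stubs BY NAME; its cone contains no `sorry` except the three stubs, axioms otherwise `[propext, Classical.choice, Quot.sound]`).

## The object: the translation hull of an eternal exterior

Write hyp(a,r₀,G) for the seven-clause antecedent of X (smooth symmetric invertible `G` on the excised cylinder
`Kerr.region a r₀ = ℝ_t × {r(a,x⃗) > max r₀ 0}`, uniformly spacelike slices, spacelike-inflow collar, `Ric = 0`, harmonic
gauge, all `C^k` norms of `G` and `‖G⁻¹‖` bounded, stationary-rate fall-off) and `τ_s G := G(· + s e₀)`.  Every clause of
hyp is invariant under `τ_s` and closed under `C^∞_loc` limits with the SAME constants, and the uniform `C^k` bounds make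
`{τ_s G : s ∈ ℝ}` precompact in `C^∞_loc` (Arzelà–Ascoli).  So the closure `𝓗(G)` of the orbit is a compact metrisable
space carrying the continuous flow `τ`, entirely inside X's class, and X says: every point of every hull is a fixed point.
Topological dynamics then splits X into three pieces of different natures:

* `stub_hullRecurrence` (H, GLUE — a theorem of analysis + Birkhoff, provable now, size L): for every `G` with hyp there are
  `G'` with hyp and times `σ n → −∞` such that `τ_{σ n} G → G'` in `C^∞_loc` (an α-limit point), and `G'` is UNIFORMLY
  RECURRENT (every `C^k`-on-compacts neighbourhood of `G'` is revisited by `τ_s G'` in every time window of some length `L`).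
  Proof: Arzelà–Ascoli + closedness of the clauses give a compact invariant α-limit set; it contains a minimal set
  (Zorn); points of minimal sets of compact flows are uniformly recurrent (Birkhoff / Gottschalk–Hedlund).
* `stub_recurrentRigidity` (P, the NON-PERTURBATIVE CORE, open): a uniformly recurrent member of X's class is stationary —
  "no recurrent vacuum black-hole breathers" (contains the time-periodic case: Papapetrou 1957, Bičák–Scholtz–Tod 2010,
  Alexakis–Schlue arXiv:1504.04592, all near infinity only).  What recurrence buys at THIS step: every CONTINUOUS monotone
  (Lyapunov) functional of the flow is CONSTANT along a recurrent orbit (two-sided Poisson stability + semicontinuity), so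
  P is a LaSalle statement — exhibit one hull-continuous functional strictly monotone off the stationary locus (candidates:
  event/apparent-horizon area and Hawking's area law ⇒ a recurrent horizon is non-expanding and shear-free for all time ⇒
  near-horizon Killing field by the bifurcate Alexakis–Ionescu–Klainerman rigidity arXiv:0902.1173 after a Rácz–Wald
  extension, then OUTWARD Ionescu–Klainerman Killing extension across the level sets of r, which are null-convex from the
  horizon side exactly up to the photon shell, meeting the INWARD sweep from the Rellich zone, null-convex from outside
  exactly down to the photon shell — no time-analyticity anywhere; the photon shell of a rotating limit is the residue).
* `stub_pastApproachRigidity` (Q, the PERTURBATIVE PIECE, open but inside Kerr technology): a member of X's class which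
  comes `C^∞_loc`-arbitrarily close to a STATIONARY member along times `σ n → −∞` is itself stationary.  Why easier than X:
  the limit objects live on the stationary member, which (item 18040 `StationaryHarmonicExteriorIsKerr`, or Q's own proof)
  is a sub-extremal Kerr exterior — extremal pieces are excluded from X's class by the inflow collar, whose `∂_t`-invariant
  spacelike leaves must meet the axis where `∂_t` is spacelike only for `r₋ < r < r₊` — so the full linear theory on EXACT
  Kerr applies to normalised differences: mode stability on the closed upper half-plane (Whiting 1989, arXiv:1302.6902,
  arXiv:1607.02759, arXiv:1910.02854), boundedness + integrated decay (arXiv:1402.7034, arXiv:2007.07211, arXiv:2302.08916),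
  nonlinear Kerr capture (arXiv:2104.11857, arXiv:2205.14808; full |a|<M claimed arXiv:2606.28253); ADM mass is continuous
  on the hull and constant on orbits (flux form of the constraints with `D²G = O(ρ⁻³)`), so `G'` has the mass of `G`; the
  approach being from the PAST, forward capture from the data at time `σ n` pins `G` at every fixed later time to within
  `o(1)` of an exactly stationary configuration, i.e. `G` is stationary.  The one non-published input: transporting the
  capture theorem's asymptotic gauge into the a-priori harmonic chart = the LINEAR scalar Liouville theorem for eternal
  bounded non-radiating solutions of `□_{Kerr} φ = 0` (harmonic coordinates are wave coordinates), which follows from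
  arXiv:1402.7034 by the energy argument recorded in STRATEGY-CENSUS.md §Transfer.

Composition (proved below): given hyp(G), H yields `(G', σ)`; P makes `G'` stationary; Q transports stationarity back
to `G` along the past approach.  Hence X.  Conversely X ⇒ P and X ⇒ Q trivially (both are X with extra hypotheses) and
H is a theorem, so the cut is exact: X ⟺ P ∧ Q over H; neither P nor Q alone gives X (P needs an approach statement, Q
needs a stationary point in the α-limit set), and no stub mentions the summit.

## Relation to the registered lines (why this is not the band or the strip again)

Both existing cuts are "MANUFACTURE time-regularity (compact temporal band / uniform strip) from non-radiation, then
CONSUME it by partially-analytic unique continuation"; their common stall is the analyticity-producing half (semiclassics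
gives decay, not a band or a strip, on a background with unknown trapping) and the ergo-belt of the consuming half.  This
line manufactures no regularity in `t` at all: it trades X for (recurrence-rigidity) + (rigidity of the approach to the
stationary locus), i.e. a LaSalle principle on the compact hull.  Its perturbative piece Q is exactly where the sibling
lines have nothing to say and where the Kerr literature is complete; its core P is strictly weaker than X and carries new
structure (constancy of every continuous Lyapunov functional; pure-point flavour of the dynamics) that X's general member
lacks.  Honest residue: P on a rotating, far-from-Kerr recurrent member still faces the photon shell (see the card
`Lines/recur.md`, Hardest stub, and STRATEGY-CENSUS.md §Decomposition).

Disproof used: none exists for this crux (no `Cruxes/EternalExteriorStationary/Disproof.lean`, no landed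
`Theorems/EternalExteriorStationary/Negative/*`, 2026-08-17); negatives index: 1 unrelated entry
(`not_UniformPhotonSphereChannels`).  Non-vacuity of hyp (refuter EVIDENCE.md, CAS j002064: Schwarzschild in Cook–Scheel
harmonic coordinates) is inherited by all three stubs, which carry hyp verbatim.
-/

set_option linter.dupNamespace false

noncomputable section

namespace Summit.FinalStateConjecture.FinalStateConjecture.Cruxes.EternalExteriorStationary.Recur

/-! ## The three registered stubs (`sorry` only here; signatures self-contained via `open … in`) -/

/-- **Registered stub H — HULL RECURRENCE (glue; provable now, size L).**  For every `(a, r₀, G)` satisfying the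
seven hypothesis clauses of X there are `G'` satisfying the same clauses (same `a, r₀`) and a sequence of times
`σ n → −∞` such that the translates `G(· + σ n • e₀)` converge to `G'` uniformly with all derivatives on every compact
subset of the cylinder (an α-limit point of the translation flow), and `G'` is UNIFORMLY RECURRENT: for every `k`,
compact `K` and `ε > 0` there is `L > 0` such that every window `[T, T + L]` contains an `s` with
`‖D^j G'(x + s e₀) − D^j G'(x)‖ ≤ ε` for all `x ∈ K`, `j ≤ k`.
Why true: the clauses are translation-invariant and closed under `C^∞_loc` limits with the same constants; uniform
`C^{k+1}` bounds make the orbit equi-Lipschitz on compacts, so Arzelà–Ascoli + a diagonal argument give sequential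
compactness of the orbit closure in `C^∞_loc` (metrisable); the α-limit set is nonempty, compact and invariant, contains
a minimal set (Zorn), and points of minimal sets of a continuous flow on a compact metric space are uniformly recurrent
(Birkhoff recurrence theorem; Gottschalk–Hedlund 1955 Ch. 4).  Invertibility of the limit: `‖G⁻¹‖ ≤ C` uniformly.
Size: L (Arzelà–Ascoli for all derivatives on an open subset of `E4`, closedness of seven clauses, Birkhoff).
Sources: Gottschalk–Hedlund, *Topological Dynamics* (AMS Colloq. 36, 1955) Thm 4.05–4.07; Furstenberg,
*Recurrence in ergodic theory and combinatorial number theory* (1981) Thm 1.15; Mathlib `BoundedContinuousFunction.arzela_ascoli`. -/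
theorem stub_hullRecurrence :
    open Literature.Geometry.Lorentzian in ∀ (a r₀ : ℝ) (G : E4 → E4 →L[ℝ] E4 →L[ℝ] ℝ), (0 < r₀ ∧ MetricCoord.IsMetricOn G (Kerr.region a r₀ : Set E4) ∧ (∃ c₀ δ : ℝ, 0 < c₀ ∧ 0 < δ ∧ ∀ x ∈ Kerr.region a r₀, (E4.dx 0) (MetricCoord.sharpAt G x (E4.dx 0)) ≤ -c₀ ∧ (Kerr.radius a x < r₀ + δ → (fderiv ℝ (Kerr.radius a) x) (MetricCoord.sharpAt G x (fderiv ℝ (Kerr.radius a) x)) ≤ -c₀ ∧ c₀ ≤ (E4.dx 0) (MetricCoord.sharpAt G x (fderiv ℝ (Kerr.radius a) x)))) ∧ (∀ x ∈ Kerr.region a r₀, MetricCoord.ricAt G x = 0) ∧ (∀ x ∈ Kerr.region a r₀, ∑ β : Fin 4, MetricCoord.chrAt G x (MetricCoord.sharpAt G x (E4.dx β)) (E4.basisVector β) = 0) ∧ (∀ k : ℕ, ∃ C : ℝ, ∀ x ∈ Kerr.region a r₀, ‖iteratedFDeriv ℝ k G x‖ ≤ C ∧ ‖MetricCoord.sharpAt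 G x‖ ≤ C) ∧ (∃ C : ℝ, ∀ x ∈ Kerr.region a r₀, ‖G x - Minkowski.bilin‖ ≤ C / E4.spatialNorm x ∧ ‖iteratedFDeriv ℝ 1 G x‖ ≤ C / E4.spatialNorm x ^ 2 ∧ ‖iteratedFDeriv ℝ 2 G x‖ ≤ C / E4.spatialNorm x ^ 3)) → ∃ (G' : E4 → E4 →L[ℝ] E4 →L[ℝ] ℝ) (σ : ℕ → ℝ), (0 < r₀ ∧ MetricCoord.IsMetricOn G' (Kerr.region a r₀ : Set E4) ∧ (∃ c₀ δ : ℝ, 0 < c₀ ∧ 0 < δ ∧ ∀ x ∈ Kerr.region a r₀, (E4.dx 0) (MetricCoord.sharpAt G' x (E4.dx 0)) ≤ -c₀ ∧ (Kerr.radius a x < r₀ + δ → (fderiv ℝ (Kerr.radius a) x) (MetricCoord.sharpAt G' x (fderiv ℝ (Kerr.radius a) x)) ≤ -c₀ ∧ c₀ ≤ (E4.dx 0) (MetricCoord.sharpAt G' x (fderiv ℝ (Kerr.radius a) x)))) ∧ (∀ x ∈ Kerr.region a r₀, MetricCoord.ricAt G' x = 0) ∧ (∀ x ∈ Kerr.region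 a r₀, ∑ β : Fin 4, MetricCoord.chrAt G' x (MetricCoord.sharpAt G' x (E4.dx β)) (E4.basisVector β) = 0) ∧ (∀ k : ℕ, ∃ C : ℝ, ∀ x ∈ Kerr.region a r₀, ‖iteratedFDeriv ℝ k G' x‖ ≤ C ∧ ‖MetricCoord.sharpAt G' x‖ ≤ C) ∧ (∃ C : ℝ, ∀ x ∈ Kerr.region a r₀, ‖G' x - Minkowski.bilin‖ ≤ C / E4.spatialNorm x ∧ ‖iteratedFDeriv ℝ 1 G' x‖ ≤ C / E4.spatialNorm x ^ 2 ∧ ‖iteratedFDeriv ℝ 2 G' x‖ ≤ C / E4.spatialNorm x ^ 3)) ∧ Filter.Tendsto σ Filter.atTop Filter.atBot ∧ (∀ (k : ℕ) (K : Set E4), IsCompact K → K ⊆ (Kerr.region a r₀ : Set E4) → ∀ ε : ℝ, 0 < ε → ∃ N : ℕ, ∀ n : ℕ, N ≤ n → ∀ x ∈ K, ‖iteratedFDeriv ℝ k G (x + σ n • E4.basisVector 0) - iteratedFDeriv ℝ k G' x‖ ≤ ε) ∧ (∀ (k : ℕ) (K : Set E4), IsCompact K → K ⊆ (Kerr.region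 a r₀ : Set E4) → ∀ ε : ℝ, 0 < ε → ∃ L : ℝ, 0 < L ∧ ∀ T : ℝ, ∃ s : ℝ, T ≤ s ∧ s ≤ T + L ∧ ∀ x ∈ K, ∀ j : ℕ, j ≤ k → ‖iteratedFDeriv ℝ j G' (x + s • E4.basisVector 0) - iteratedFDeriv ℝ j G' x‖ ≤ ε) := by
  sorry

/-- **Registered stub P — RECURRENT RIGIDITY (the non-perturbative core; open).**  A member of X's class which is
uniformly recurrent under time translation (in the `C^∞_loc` sense of stub H) is `t`-independent: "no recurrent — in
particular no time-periodic — vacuum black-hole breathers".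
Why plausibly true: it is X restricted to the recurrent part of the hull, and recurrence is exactly what turns the
one-sided dissipation of general relativity into rigidity: along a two-sided Poisson-stable orbit every hull-continuous
monotone functional is constant (LaSalle), so Hawking's area law forces a recurrent event horizon to be non-expanding and
shear-free for all time (vacuum Raychaudhuri), the near-horizon geometry is then Killing (bifurcate rigidity without
analyticity, Alexakis–Ionescu–Klainerman arXiv:0902.1173, after attaching the bifurcation sphere à la Rácz–Wald), and the
Ionescu–Klainerman Killing-extension theorem (doi:10.1090/s0894-0347-2012-00754-1, JAMS 26 (2013), Thm 1.1: extension across strongly pseudo-convex hypersurfaces) sweeps OUTWARD across the `r`-level sets, which are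
null-convex from the horizon side up to the photon shell, while the Rellich-zone argument (Alexakis–Schlue
arXiv:1504.04592, Bičák–Scholtz–Tod 2010) sweeps INWARD down to it; for a non-rotating limit the two sweeps meet on the
photon sphere and continuity closes X with no time-analyticity.  The periodic sub-case is the classical Papapetrou
problem with a hole.
Why it might fail: a time-periodic (or almost-periodic) vacuum breather in X's class — hair parked on the open photon
shell / ergo-belt of a rotating non-Kerr recurrent exterior — refutes it; hull-continuity of the horizon area
(teleology of the event horizon) and the Rácz–Wald attachment for a merely non-expanding horizon are unproved; the two
sweeps leave the open photon shell of a rotating limit uncovered (Ionescu–Klainerman non-extension barrier applies there).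
Size: open-problem (strictly weaker than X).  Sources: arXiv:1504.04592, doi:10.1088/0264-9381/27/17/175011,
doi:10.1002/andp.19574550709, arXiv:0902.1173, doi:10.1090/s0894-0347-2012-00754-1 (IK 2013), doi:10.1088/0264-9381/9/12/008 and doi:10.1088/0264-9381/13/3/017 (Rácz–Wald 1992/1996). -/
theorem stub_recurrentRigidity :
    open Literature.Geometry.Lorentzian in ∀ (a r₀ : ℝ) (G' : E4 → E4 →L[ℝ] E4 →L[ℝ] ℝ), (0 < r₀ ∧ MetricCoord.IsMetricOn G' (Kerr.region a r₀ : Set E4) ∧ (∃ c₀ δ : ℝ, 0 < c₀ ∧ 0 < δ ∧ ∀ x ∈ Kerr.region a r₀, (E4.dx 0) (MetricCoord.sharpAt G' x (E4.dx 0)) ≤ -c₀ ∧ (Kerr.radius a x < r₀ + δ → (fderiv ℝ (Kerr.radius a) x) (MetricCoord.sharpAt G' x (fderiv ℝ (Kerr.radius a) x)) ≤ -c₀ ∧ c₀ ≤ (E4.dx 0) (MetricCoord.sharpAt G' x (fderiv ℝ (Kerr.radius a) x)))) ∧ (∀ x ∈ Kerr.region a r₀, MetricCoord.ricAt G' x =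 0) ∧ (∀ x ∈ Kerr.region a r₀, ∑ β : Fin 4, MetricCoord.chrAt G' x (MetricCoord.sharpAt G' x (E4.dx β)) (E4.basisVector β) = 0) ∧ (∀ k : ℕ, ∃ C : ℝ, ∀ x ∈ Kerr.region a r₀, ‖iteratedFDeriv ℝ k G' x‖ ≤ C ∧ ‖MetricCoord.sharpAt G' x‖ ≤ C) ∧ (∃ C : ℝ, ∀ x ∈ Kerr.region a r₀, ‖G' x - Minkowski.bilin‖ ≤ C / E4.spatialNorm x ∧ ‖iteratedFDeriv ℝ 1 G' x‖ ≤ C / E4.spatialNorm x ^ 2 ∧ ‖iteratedFDeriv ℝ 2 G' x‖ ≤ C / E4.spatialNorm x ^ 3)) → (∀ (k : ℕ) (K : Set E4), IsCompact K → K ⊆ (Kerr.region a r₀ : Set E4) → ∀ ε : ℝ, 0 < ε → ∃ L : ℝ, 0 < L ∧ ∀ T : ℝ, ∃ s : ℝ, T ≤ s ∧ s ≤ T + L ∧ ∀ x ∈ K, ∀ j : ℕ, j ≤ k → ‖iteratedFDeriv ℝ j G' (x + s • E4.basisVector 0) - iteratedFDeriv ℝ j G' x‖ ≤ ε) → ∀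 x ∈ Kerr.region a r₀, ∀ s : ℝ, G' (x + s • E4.basisVector 0) = G' x := by
  sorry

/-- **Registered stub Q — PAST-APPROACH RIGIDITY (the perturbative piece; open, inside Kerr technology).**  If `G` is in
X's class and some translates `G(· + σ n • e₀)` with `σ n → −∞` converge in `C^∞_loc` to a STATIONARY member `G'` of X's
class, then `G` is `t`-independent: the stationary locus has no non-trivial unstable set inside the dark eternal class.
Why plausibly true / why easier than X: the stationary member is a sub-extremal Kerr exterior (route item 18040
`StationaryHarmonicExteriorIsKerr`; extremal pieces are excluded by the inflow collar), so normalised differences live on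
EXACT Kerr, where mode stability on the closed upper half-plane (Whiting; arXiv:1302.6902; arXiv:1607.02759;
arXiv:1910.02854), boundedness + integrated local energy decay (arXiv:1402.7034; Teukolsky arXiv:2007.07211,
arXiv:2302.08916) and nonlinear capture (arXiv:2104.11857, arXiv:2205.14808, claimed for all |a|<M in arXiv:2606.28253)
are available; the ADM mass is hull-continuous and orbit-constant, so `G'` carries the mass of `G`; since the approach
is from the PAST, forward capture from the data at time `σ n` pins `G` at each fixed later time to within `o_n(1)` of an
exactly stationary configuration.  Remaining non-published input: transport of the capture gauge into the a-priori
harmonic chart = the linear scalar Liouville theorem for eternal bounded non-radiating solutions of `□_Kerr φ = 0`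
(energy argument on arXiv:1402.7034, STRATEGY-CENSUS.md §Transfer) and the weighted-tail smallness of `G − G'` at time
`σ n` (local closeness is only on compacts; tails agree to `O(ρ⁻¹)` with equal mass).
Why it might fail: only through a failure of Kerr capture in the eternal dark class for large |a|/M, or an ADM angular
momentum that is NOT hull-continuous under the bare `O(ρ⁻¹)` fall-off (no parity clause), letting the spin of the limit
differ from orbit to orbit.  Size: XL but perturbative.  Sources: arXiv:1402.7034, arXiv:1302.6902, arXiv:2205.14808,
arXiv:2606.28253, doi:10.1063/1.528308 (Whiting 1989). -/
theorem stub_pastApproachRigidity :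
    open Literature.Geometry.Lorentzian in ∀ (a r₀ : ℝ) (G G' : E4 → E4 →L[ℝ] E4 →L[ℝ] ℝ) (σ : ℕ → ℝ), (0 < r₀ ∧ MetricCoord.IsMetricOn G (Kerr.region a r₀ : Set E4) ∧ (∃ c₀ δ : ℝ, 0 < c₀ ∧ 0 < δ ∧ ∀ x ∈ Kerr.region a r₀, (E4.dx 0) (MetricCoord.sharpAt G x (E4.dx 0)) ≤ -c₀ ∧ (Kerr.radius a x < r₀ + δ → (fderiv ℝ (Kerr.radius a) x) (MetricCoord.sharpAt G x (fderiv ℝ (Kerr.radius a) x)) ≤ -c₀ ∧ c₀ ≤ (E4.dx 0) (MetricCoord.sharpAt G x (fderiv ℝ (Kerr.radius a) x)))) ∧ (∀ x ∈ Kerr.region a r₀, MetricCoord.ricAt G x = 0) ∧ (∀ x ∈ Kerr.region a r₀, ∑ β : Fin 4, MetricCoord.chrAt G x (MetricCoord.sharpAt G x (E4.dx β)) (E4.basisVector β) = 0) ∧ (∀ k : ℕ, ∃ C : ℝ, ∀ x ∈ Kerr.region a r₀, ‖iteratedFDeriv ℝ k G x‖ ≤ C ∧ ‖MetricCoord.sharpAt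 G x‖ ≤ C) ∧ (∃ C : ℝ, ∀ x ∈ Kerr.region a r₀, ‖G x - Minkowski.bilin‖ ≤ C / E4.spatialNorm x ∧ ‖iteratedFDeriv ℝ 1 G x‖ ≤ C / E4.spatialNorm x ^ 2 ∧ ‖iteratedFDeriv ℝ 2 G x‖ ≤ C / E4.spatialNorm x ^ 3)) → (0 < r₀ ∧ MetricCoord.IsMetricOn G' (Kerr.region a r₀ : Set E4) ∧ (∃ c₀ δ : ℝ, 0 < c₀ ∧ 0 < δ ∧ ∀ x ∈ Kerr.region a r₀, (E4.dx 0) (MetricCoord.sharpAt G' x (E4.dx 0)) ≤ -c₀ ∧ (Kerr.radius a x < r₀ + δ → (fderiv ℝ (Kerr.radius a) x) (MetricCoord.sharpAt G' x (fderiv ℝ (Kerr.radius a) x)) ≤ -c₀ ∧ c₀ ≤ (E4.dx 0) (MetricCoord.sharpAt G' x (fderiv ℝ (Kerr.radius a) x)))) ∧ (∀ x ∈ Kerr.region a r₀, MetricCoord.ricAt G' x = 0) ∧ (∀ x ∈ Kerr.region a r₀, ∑ β : Fin 4, MetricCoord.chrAt G' x (MetricCoord.sharpAt G' x (E4.dx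 β)) (E4.basisVector β) = 0) ∧ (∀ k : ℕ, ∃ C : ℝ, ∀ x ∈ Kerr.region a r₀, ‖iteratedFDeriv ℝ k G' x‖ ≤ C ∧ ‖MetricCoord.sharpAt G' x‖ ≤ C) ∧ (∃ C : ℝ, ∀ x ∈ Kerr.region a r₀, ‖G' x - Minkowski.bilin‖ ≤ C / E4.spatialNorm x ∧ ‖iteratedFDeriv ℝ 1 G' x‖ ≤ C / E4.spatialNorm x ^ 2 ∧ ‖iteratedFDeriv ℝ 2 G' x‖ ≤ C / E4.spatialNorm x ^ 3)) → (∀ x ∈ Kerr.region a r₀, ∀ s : ℝ, G' (x + s • E4.basisVector 0) = G' x) → Filter.Tendsto σ Filter.atTop Filter.atBot → (∀ (k : ℕ) (K : Set E4), IsCompact K → K ⊆ (Kerr.region a r₀ : Set E4) → ∀ ε : ℝ, 0 < ε → ∃ N : ℕ, ∀ n : ℕ, N ≤ n → ∀ x ∈ K, ‖iteratedFDeriv ℝ k G (x + σ n • E4.basisVector 0) - iteratedFDeriv ℝ k G' x‖ ≤ ε) → ∀ x ∈ Kerr.region a r₀, ∀ s : ℝ, G (x + s • E4.basisVector 0) =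 G x := by
  sorry

/-! ## The composition: the crux BY NAME from the three registered stubs -/

/-- **X from H, P, Q (the skeleton theorem).**  Given the hypothesis bundle `hG` of X for `(a, r₀, G)`: stub H yields an
α-limit point `G'` in the class, uniformly recurrent, approached along `σ n → −∞`; stub P makes `G'` stationary; stub Q
carries stationarity back to `G`.  The only `sorry`s in its cone are the three registered stubs, used BY NAME (two `obtain`/`exact` lines of
logic). -/
theorem EternalExteriorStationary_of : Theses.TemporalBandLiouville.EternalExteriorStationary := by
  intro a r₀ G hG
  obtain ⟨G', σ, hG', hσ, hconv, hrec⟩ := stub_hullRecurrence a r₀ G hG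
  exact stub_pastApproachRigidity a r₀ G G' σ hG hG' (stub_recurrentRigidity a r₀ G' hG' hrec) hσ hconv

/-! ## Sanity of the cut: P and Q are consequences of X (so neither is stronger than the crux) -/

/-- X → P: P is X restricted to uniformly recurrent members. -/
theorem recurrentRigidity_of_eternal (hX : Theses.TemporalBandLiouville.EternalExteriorStationary) :
    open Literature.Geometry.Lorentzian in ∀ (a r₀ : ℝ) (G' : E4 → E4 →L[ℝ] E4 →L[ℝ] ℝ), (0 < r₀ ∧ MetricCoord.IsMetricOn G' (Kerr.region a r₀ : Set E4) ∧ (∃ c₀ δ : ℝ, 0 < c₀ ∧ 0 < δ ∧ ∀ x ∈ Kerr.region a r₀, (E4.dx 0) (MetricCoord.sharpAt G' x (E4.dx 0)) ≤ -c₀ ∧ (Kerr.radius a x < r₀ + δ → (fderiv ℝ (Kerr.radius a) x) (MetricCoord.sharpAt G' x (fderiv ℝ (Kerr.radius a) x)) ≤ -c₀ ∧ c₀ ≤ (E4.dx 0) (MetricCoord.sharpAt G' x (fderiv ℝ (Kerr.radius a) x)))) ∧ (∀ x ∈ Kerr.region a r₀, MetricCoord.ricAt G' x = 0) ∧ (∀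 x ∈ Kerr.region a r₀, ∑ β : Fin 4, MetricCoord.chrAt G' x (MetricCoord.sharpAt G' x (E4.dx β)) (E4.basisVector β) = 0) ∧ (∀ k : ℕ, ∃ C : ℝ, ∀ x ∈ Kerr.region a r₀, ‖iteratedFDeriv ℝ k G' x‖ ≤ C ∧ ‖MetricCoord.sharpAt G' x‖ ≤ C) ∧ (∃ C : ℝ, ∀ x ∈ Kerr.region a r₀, ‖G' x - Minkowski.bilin‖ ≤ C / E4.spatialNorm x ∧ ‖iteratedFDeriv ℝ 1 G' x‖ ≤ C / E4.spatialNorm x ^ 2 ∧ ‖iteratedFDeriv ℝ 2 G' x‖ ≤ C / E4.spatialNorm x ^ 3)) → (∀ (k : ℕ) (K : Set E4), IsCompact K → K ⊆ (Kerr.region a r₀ : Set E4) → ∀ ε : ℝ, 0 < ε → ∃ L : ℝ, 0 < L ∧ ∀ T : ℝ, ∃ s : ℝ, T ≤ s ∧ s ≤ T + L ∧ ∀ x ∈ K, ∀ j : ℕ, j ≤ k → ‖iteratedFDeriv ℝ j G' (x + s • E4.basisVector 0) - iteratedFDeriv ℝ j G' x‖ ≤ ε) → ∀ x ∈ Kerr.region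 a r₀, ∀ s : ℝ, G' (x + s • E4.basisVector 0) = G' x :=
  fun a r₀ G' hG' _ => hX a r₀ G' hG'

/-- X → Q: Q is X restricted to members with a stationary past-approach. -/
theorem pastApproachRigidity_of_eternal (hX : Theses.TemporalBandLiouville.EternalExteriorStationary) :
    open Literature.Geometry.Lorentzian in ∀ (a r₀ : ℝ) (G G' : E4 → E4 →L[ℝ] E4 →L[ℝ] ℝ) (σ : ℕ → ℝ), (0 < r₀ ∧ MetricCoord.IsMetricOn G (Kerr.region a r₀ : Set E4) ∧ (∃ c₀ δ : ℝ, 0 < c₀ ∧ 0 < δ ∧ ∀ x ∈ Kerr.region a r₀, (E4.dx 0) (MetricCoord.sharpAt G x (E4.dx 0)) ≤ -c₀ ∧ (Kerr.radius a x < r₀ + δ → (fderiv ℝ (Kerr.radius a) x) (MetricCoord.sharpAt G x (fderiv ℝ (Kerr.radius a) x)) ≤ -c₀ ∧ c₀ ≤ (E4.dx 0) (MetricCoord.sharpAt G x (fderiv ℝ (Kerr.radius a) x)))) ∧ (∀ x ∈ Kerr.region a r₀, MetricCoord.ricAt G x = 0) ∧ (∀ x ∈ Kerr.region a r₀, ∑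 β : Fin 4, MetricCoord.chrAt G x (MetricCoord.sharpAt G x (E4.dx β)) (E4.basisVector β) = 0) ∧ (∀ k : ℕ, ∃ C : ℝ, ∀ x ∈ Kerr.region a r₀, ‖iteratedFDeriv ℝ k G x‖ ≤ C ∧ ‖MetricCoord.sharpAt G x‖ ≤ C) ∧ (∃ C : ℝ, ∀ x ∈ Kerr.region a r₀, ‖G x - Minkowski.bilin‖ ≤ C / E4.spatialNorm x ∧ ‖iteratedFDeriv ℝ 1 G x‖ ≤ C / E4.spatialNorm x ^ 2 ∧ ‖iteratedFDeriv ℝ 2 G x‖ ≤ C / E4.spatialNorm x ^ 3)) → (0 < r₀ ∧ MetricCoord.IsMetricOn G' (Kerr.region a r₀ : Set E4) ∧ (∃ c₀ δ : ℝ, 0 < c₀ ∧ 0 < δ ∧ ∀ x ∈ Kerr.region a r₀, (E4.dx 0) (MetricCoord.sharpAt G' x (E4.dx 0)) ≤ -c₀ ∧ (Kerr.radius a x < r₀ + δ → (fderiv ℝ (Kerr.radius a) x) (MetricCoord.sharpAt G' x (fderiv ℝ (Kerr.radius a) x)) ≤ -c₀ ∧ c₀ ≤ (E4.dx 0) (MetricCoord.sharpAt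 G' x (fderiv ℝ (Kerr.radius a) x)))) ∧ (∀ x ∈ Kerr.region a r₀, MetricCoord.ricAt G' x = 0) ∧ (∀ x ∈ Kerr.region a r₀, ∑ β : Fin 4, MetricCoord.chrAt G' x (MetricCoord.sharpAt G' x (E4.dx β)) (E4.basisVector β) = 0) ∧ (∀ k : ℕ, ∃ C : ℝ, ∀ x ∈ Kerr.region a r₀, ‖iteratedFDeriv ℝ k G' x‖ ≤ C ∧ ‖MetricCoord.sharpAt G' x‖ ≤ C) ∧ (∃ C : ℝ, ∀ x ∈ Kerr.region a r₀, ‖G' x - Minkowski.bilin‖ ≤ C / E4.spatialNorm x ∧ ‖iteratedFDeriv ℝ 1 G' x‖ ≤ C / E4.spatialNorm x ^ 2 ∧ ‖iteratedFDeriv ℝ 2 G' x‖ ≤ C / E4.spatialNorm x ^ 3)) → (∀ x ∈ Kerr.region a r₀, ∀ s : ℝ, G' (x + s • E4.basisVector 0) = G' x) → Filter.Tendsto σ Filter.atTop Filter.atBot → (∀ (k : ℕ) (K : Set E4), IsCompact K → K ⊆ (Kerr.region a r₀ : Set E4) → ∀ ε : ℝ, 0 < ε → ∃ N : ℕ, ∀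 n : ℕ, N ≤ n → ∀ x ∈ K, ‖iteratedFDeriv ℝ k G (x + σ n • E4.basisVector 0) - iteratedFDeriv ℝ k G' x‖ ≤ ε) → ∀ x ∈ Kerr.region a r₀, ∀ s : ℝ, G (x + s • E4.basisVector 0) = G x :=
  fun a r₀ G _ _ hG _ _ _ _ => hX a r₀ G hG

end Summit.FinalStateConjecture.FinalStateConjecture.Cruxes.EternalExteriorStationary.Recur

end
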